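import Literature.MathematicalPhysics.QuantumLattice.TorusThermalShellSum
import Literature.MathematicalPhysics.QuantumLattice.DWaveSourceFreePressure
import Literature.MathematicalPhysics.QuantumLattice.BdGModeGainBound
import HarnessLib

/-!
# The free torus Fermi gas has `O(T)` heat content: the dyadic pressure law
`p₀(β/2) - p₀(β) ≲ 1/β²` (Sommerfeld's `T²`-law, finite volume)

Topic `MathematicalPhysics/QuantumLattice`; consumer of the thermal shell sum
`Σ_k e^{-β|ε_L(k) - μ|/2} ≤ C(d₀)(L²/β + L)` of `TorusThermalShellSum.lean` and of the BdG
product formula `partitionFn_dWaveSourceTorus_zero_re` (`DWaveSourceFreePressure.lean`) at zero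
pair source. For the free (`U = 0`) grand-canonical Hubbard torus `hubbardTorusWith 2 L 1 0 μ`
(`L ≥ 3`) and `μ` at distance `≥ d₀` from `{-4, 0}` we PROVE:

* `log_partitionFn_hubbardTorusWith_zero_eq` —
  `log Z_β = (2L²) log 2 + Σ_k [-βξ_k + 2 log cosh(βξ_k/2)]` (`= Σ_k 2 log(1 + e^{-βξ_k})`,
  `ξ_k = ε_L(k) - μ`);
* `dyadicHeat_mode_le` / `two_mul_log_partitionFn_half_sub_le` — the dyadic heat identity
  `2 log Z_{β/2} - log Z_β = Σ_k 2 log(1 + 1/cosh(βξ_k/2)) ≤ 4 Σ_k e^{-β|ξ_k|/2}`;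
* `exists_free_dyadicPressure_sub_le` — **the dyadic pressure law**
  `p₀(β/2) - p₀(β) ≤ C₁(d₀)(1/β² + 1/(βL))` for `β ≥ 1`, `L ≥ 3`, `p₀(b) = log Z_b/(bL²)`;
* `free_dyadicPressure_sub_le` (and `…_source_zero`, the `dWaveSourceTorus L 0 μ 0` spelling) —
  its packaging on compacts `[μ₁,μ₂] ⊂ (-4,0)`, eventually in `L` (`L ≥ max 3 ⌈β⌉`):
  `p₀(β/2) - p₀(β) ≤ C₁/β²` — the heat released by the free `d = 2` lattice Fermi gas between the
  temperatures `2T` and `T` is `O(T²)` per site (linear specific heat, Sommerfeld), away from the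
  band edge and the van Hove energy, once the torus resolves the thermal shell.

Consumers: the thermal (entropy / heat-chord) inputs at `U = 0` of the `ThermalWedge` cruxes
`TwSourcedInertness` / `TwSourcedCondensation` of `Summits/HubbardSuperconductivity` (the sourced
free heat chord is dominated by the source-free one: `free_heatChord_le_zero_source` in
`Theorems/TwSourcedCondensation/Negative/StubThermalLaw.lean`).

Sources: A. Sommerfeld, Z. Phys. 47 (1928) 1 (the `T²` law); N. W. Ashcroft, N. D. Mermin,
*Solid State Physics* (1976) Ch. 2, eqs. (2.49) and (2.79)–(2.81) (grand potential and specific heat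
`γT` of the free electron gas) [AshcroftMermin1976]; M. Salmhofer, *Renormalization* (1999)
§4.2–4.5 [Salmhofer1999]. Everything is proved; no definition and no named fact.
-/

noncomputable section

namespace Literature.MathematicalPhysics.QuantumLattice

open Real Set Finset Matrix Literature.Probability.LatticeModels

/-! ### The free partition function at `U = 0` and the dyadic heat identity -/

section Free

variable {L : ℕ} [NeZero L]

/-- **The free grand-canonical partition function** (`U = 0`, `L ≥ 3`):
`log Z_β(hubbardTorusWith 2 L 1 0 μ) = (2L²) log 2 + Σ_k [-βξ_k + 2 log cosh(βξ_k/2)]`,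
`ξ_k = ε_L(k) - μ` — i.e. `Z = Π_k (1 + e^{-βξ_k})²` — from the BdG product formula of the tree at
zero pair source. [cite: AshcroftMermin1976, Ch. 2 eq. (2.49)] -/
theorem log_partitionFn_hubbardTorusWith_zero_eq (hL : 3 ≤ L) (β μ : ℝ) :
    Real.log (partitionFn β (hubbardTorusWith 2 L 1 0 μ)).re =
      (Fintype.card (Orb (FermionTorus 2 L)) : ℝ) * Real.log 2 +
        ∑ k : TorusSite 2 L, (-(β * (torusBand L k - μ)) +
          2 * Real.log (Real.cosh (β * (torusBand L k - μ) / 2))) := by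
  rw [← dWaveSourceTorus_zero L 0 μ, partitionFn_dWaveSourceTorus_zero_re hL β μ 0]
  have hpow : (0 : ℝ) < (2 : ℝ) ^ Fintype.card (Orb (FermionTorus 2 L)) := by positivity
  have hfac : ∀ k : TorusSite 2 L, Real.exp (-(β * (torusBand L k - μ))) *
      ((1 + Real.cosh (β * Real.sqrt ((torusBand L k - μ) ^ 2 +
        (2 * Real.sqrt 2 * 0 * dWaveGap k) ^ 2))) / 2) ≠ 0 :=
    fun k => (bdgModeFactor_pos β _ _).ne'
  rw [Real.log_mul hpow.ne' (Finset.prod_ne_zero_iff.2 fun k _ => hfac k), Real.log_pow,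
    Real.log_prod (s := Finset.univ) (hf := fun k _ => hfac k)]
  congr 1
  refine Finset.sum_congr rfl fun k _ => ?_
  have hcosh : 0 < (1 + Real.cosh (β * Real.sqrt ((torusBand L k - μ) ^ 2 +
      (2 * Real.sqrt 2 * 0 * dWaveGap k) ^ 2))) / 2 := by
    have := Real.one_le_cosh (β * Real.sqrt ((torusBand L k - μ) ^ 2 +
      (2 * Real.sqrt 2 * 0 * dWaveGap k) ^ 2))
    positivity
  rw [Real.log_mul (Real.exp_pos _).ne' hcosh.ne', Real.log_exp]
  congr 1
  rw [mul_zero, zero_mul, zero_pow two_ne_zero, add_zero, Real.sqrt_sq_eq_abs]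
  have heven : Real.cosh (β * |torusBand L k - μ|) = Real.cosh (β * (torusBand L k - μ)) := by
    rcases abs_choice (torusBand L k - μ) with h | h
    · rw [h]
    · rw [h, mul_neg, Real.cosh_neg]
  rw [heven, log_one_add_cosh_div_two]

/-- `1/cosh y ≤ 2e^{-|y|}` (`cosh y ≥ e^{|y|}/2`). [folklore] -/
private theorem inv_cosh_le (y : ℝ) : 1 / Real.cosh y ≤ 2 * Real.exp (-|y|) := by
  have hc : 0 < Real.cosh y := Real.cosh_pos y
  have hge : Real.exp |y| / 2 ≤ Real.cosh y := by
    rw [← Real.cosh_abs, Real.cosh_eq]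
    linarith [Real.exp_pos (-|y|)]
  rw [div_le_iff₀ hc, Real.exp_neg]
  have hpos : 0 < Real.exp |y| := Real.exp_pos _
  field_simp
  linarith

/-- **The dyadic heat of one mode**: with `a(b) = -bξ + 2 log cosh(bξ/2)` (the mode's
contribution to `log Z_b` beyond `log 2` per spin),
`2a(β/2) - a(β) + 2 log 2 = 2 log(1 + 1/cosh(βξ/2)) ≤ 4e^{-β|ξ|/2}` (`β ≥ 0`): only modes within
`O(1/β)` of the Fermi level carry heat between the temperatures `2/β` and `1/β`. [folklore] -/
theorem dyadicHeat_mode_le {β : ℝ} (hβ : 0 ≤ β) (ξ : ℝ) :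
    2 * (-(β / 2 * ξ) + 2 * Real.log (Real.cosh (β / 2 * ξ / 2))) -
        (-(β * ξ) + 2 * Real.log (Real.cosh (β * ξ / 2))) + 2 * Real.log 2 ≤
      4 * Real.exp (-(β * |ξ|) / 2) := by
  set c := Real.cosh (β * ξ / 4) with hcdef
  set C₂ := Real.cosh (β * ξ / 2) with hC₂def
  have hc : 0 < c := Real.cosh_pos _
  have hC₂ : 0 < C₂ := Real.cosh_pos _
  have hquarter : β / 2 * ξ / 2 = β * ξ / 4 := by ring
  have hdouble : C₂ = 2 * c ^ 2 - 1 := by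
    have h := one_add_cosh (β * ξ / 2)
    rw [show β * ξ / 2 / 2 = β * ξ / 4 by ring] at h
    rw [hC₂def, hcdef]; linarith
  rw [hquarter]
  -- the left side is `2 log(2c²/C₂) = 2 log(1 + 1/C₂)`
  have hlhs : 2 * (-(β / 2 * ξ) + 2 * Real.log c) - (-(β * ξ) + 2 * Real.log C₂) + 2 * Real.log 2 =
      2 * Real.log (1 + 1 / C₂) := by
    have h1 : 1 + 1 / C₂ = 2 * c ^ 2 / C₂ := by
      rw [hdouble]
      have : (2 : ℝ) * c ^ 2 - 1 ≠ 0 := by rw [← hdouble]; exact hC₂.ne'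
      field_simp
      ring
    rw [h1, Real.log_div (by positivity) hC₂.ne', Real.log_mul two_ne_zero (by positivity),
      Real.log_pow]
    push_cast
    ring
  rw [hlhs]
  have hlog : Real.log (1 + 1 / C₂) ≤ 1 / C₂ := by
    have h := Real.log_le_sub_one_of_pos (show 0 < 1 + 1 / C₂ by positivity)
    linarith
  have hinv : 1 / C₂ ≤ 2 * Real.exp (-|β * ξ / 2|) := inv_cosh_le _
  have habs : -|β * ξ / 2| = -(β * |ξ|) / 2 := by
    rw [abs_div, abs_mul, abs_of_nonneg hβ, abs_two]; ring
  rw [habs] at hinv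
  linarith

/-- **The dyadic heat identity and bound** (`β ≥ 0`, `L ≥ 3`, all `μ`):
`2 log Z_{β/2} - log Z_β ≤ 4 Σ_k e^{-β|ξ_k|/2}` for the free torus gas at `U = 0`
(`2 log Z_{β/2} - log Z_β = Σ_k 2 log(1 + 1/cosh(βξ_k/2))`, the `log 2`'s of the two temperatures
cancelling against `2L² = 2·#(ℤ/Lℤ)²`). [folklore] -/
theorem two_mul_log_partitionFn_half_sub_le (hL : 3 ≤ L) {β : ℝ} (hβ : 0 ≤ β) (μ : ℝ) :
    2 * Real.log (partitionFn (β / 2) (hubbardTorusWith 2 L 1 0 μ)).re -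
        Real.log (partitionFn β (hubbardTorusWith 2 L 1 0 μ)).re ≤
      4 * ∑ k : TorusSite 2 L, Real.exp (-(β * |torusBand L k - μ|) / 2) := by
  rw [log_partitionFn_hubbardTorusWith_zero_eq hL, log_partitionFn_hubbardTorusWith_zero_eq hL,
    card_orb_fermionTorus_two]
  have hcardL : (Finset.univ : Finset (TorusSite 2 L)).card = L ^ 2 := by
    rw [Finset.card_univ, Fintype.card_pi, Fin.prod_univ_two, ZMod.card, sq]
  have hlog2 : ((2 * L ^ 2 : ℕ) : ℝ) * Real.log 2 = ∑ _k : TorusSite 2 L, 2 * Real.log 2 := by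
    rw [Finset.sum_const, hcardL, nsmul_eq_mul]; push_cast; ring
  have hmode := fun k : TorusSite 2 L => dyadicHeat_mode_le hβ (torusBand L k - μ)
  have hsumle := Finset.sum_le_sum fun k (_ : k ∈ (Finset.univ : Finset (TorusSite 2 L))) => hmode k
  rw [Finset.sum_add_distrib, ← hlog2, Finset.sum_sub_distrib, ← Finset.mul_sum, ← Finset.mul_sum]
    at hsumle
  linarith

end Free

/-! ### The dyadic pressure law of the free gas -/

/-- **Sommerfeld's `T²`-law, finite-volume dyadic form.** For `μ` with `μ + 4 ≥ d₀`, `-μ ≥ d₀`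
there is `C₁ = C₁(d₀)` such that for `β ≥ 1` and every `L ≥ 3` the free torus pressure
`p₀(b) = log Z_b(hubbardTorusWith 2 L 1 0 μ)/(bL²)` satisfies
`p₀(β/2) - p₀(β) ≤ C₁ (1/β² + 1/(βL))`. [cite: AshcroftMermin1976, Ch. 2 eqs. (2.79)–(2.81)] -/
theorem exists_free_dyadicPressure_sub_le {d₀ : ℝ} (hd₀ : 0 < d₀) :
    ∃ C₁ : ℝ, 0 < C₁ ∧ ∀ μ : ℝ, d₀ ≤ μ + 4 → d₀ ≤ -μ → ∀ β : ℝ, 1 ≤ β →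
      ∀ (L : ℕ) [NeZero L], 3 ≤ L →
        Real.log (partitionFn (β / 2) (hubbardTorusWith 2 L 1 0 μ)).re / (β / 2 * (L : ℝ) ^ 2) -
            Real.log (partitionFn β (hubbardTorusWith 2 L 1 0 μ)).re / (β * (L : ℝ) ^ 2) ≤
          C₁ * (1 / β ^ 2 + 1 / (β * L)) := by
  obtain ⟨C, hC, hsum⟩ := exists_sum_exp_neg_mul_abs_torusBand_le hd₀
  refine ⟨4 * C, by positivity, ?_⟩
  intro μ hμ4 hμ0 β hβ L _ hL
  have hβ0 : 0 < β := by linarith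
  have hLr : (0 : ℝ) < L := by exact_mod_cast Nat.pos_of_ne_zero (NeZero.ne L)
  have hL2 : (0 : ℝ) < (L : ℝ) ^ 2 := by positivity
  have hβL : 0 < β * (L : ℝ) ^ 2 := mul_pos hβ0 hL2
  have hD := two_mul_log_partitionFn_half_sub_le hL hβ0.le μ
  have hS := hsum μ hμ4 hμ0 β hβ L
  have hrew :
      Real.log (partitionFn (β / 2) (hubbardTorusWith 2 L 1 0 μ)).re / (β / 2 * (L : ℝ) ^ 2) -
      Real.log (partitionFn β (hubbardTorusWith 2 L 1 0 μ)).re / (β * (L : ℝ) ^ 2) =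
      (2 * Real.log (partitionFn (β / 2) (hubbardTorusWith 2 L 1 0 μ)).re -
        Real.log (partitionFn β (hubbardTorusWith 2 L 1 0 μ)).re) / (β * (L : ℝ) ^ 2) := by
    field_simp
  rw [hrew, div_le_iff₀ hβL]
  calc 2 * Real.log (partitionFn (β / 2) (hubbardTorusWith 2 L 1 0 μ)).re -
        Real.log (partitionFn β (hubbardTorusWith 2 L 1 0 μ)).re
      ≤ 4 * ∑ k : TorusSite 2 L, Real.exp (-(β * |torusBand L k - μ|) / 2) := hD
    _ ≤ 4 * (C * ((L : ℝ) ^ 2 / β + L)) := by gcongr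
    _ = 4 * C * (1 / β ^ 2 + 1 / (β * L)) * (β * (L : ℝ) ^ 2) := by
        field_simp

/-- **The free thermal law on compacts of `(-4, 0)`, eventually in `L`.** For every
`[μ₁,μ₂] ⊂ (-4,0)` there is `C₁ > 0` such that for all `β ≥ 1` and `μ ∈ [μ₁,μ₂]`, for all
`L ≥ max 3 ⌈β⌉`: `p₀(β/2) - p₀(β) ≤ C₁/β²` — the heat released by the free torus Fermi gas between
the temperatures `2T` and `T` is `O(T²)` per site (linear specific heat), once the torus resolves
the thermal shell (`L ≳ β`; some growth of the threshold with `β` is necessary: a level exactly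
at `μ` carries heat `2 log 2/(βL²)`). [cite: AshcroftMermin1976, Ch. 2 eqs. (2.79)–(2.81)] -/
theorem free_dyadicPressure_sub_le :
    ∀ μ₁ μ₂ : ℝ, -4 < μ₁ → μ₁ ≤ μ₂ → μ₂ < 0 → ∃ C₁ : ℝ, 0 < C₁ ∧
      ∀ β : ℝ, 1 ≤ β → ∀ μ ∈ Set.Icc μ₁ μ₂, ∃ L₀ : ℕ, ∀ (L : ℕ) [NeZero L], L₀ ≤ L →
        Real.log (partitionFn (β / 2) (hubbardTorusWith 2 L 1 0 μ)).re / (β / 2 * (L : ℝ) ^ 2) -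
            Real.log (partitionFn β (hubbardTorusWith 2 L 1 0 μ)).re / (β * (L : ℝ) ^ 2) ≤
          C₁ / β ^ 2 := by
  intro μ₁ μ₂ h4 _h12 h0
  set d₀ := min (μ₁ + 4) (-μ₂) with hd₀def
  have hd₀ : 0 < d₀ := lt_min (by linarith) (by linarith)
  obtain ⟨C₁, hC₁, hlaw⟩ := exists_free_dyadicPressure_sub_le hd₀
  refine ⟨2 * C₁, by positivity, ?_⟩
  intro β hβ μ hμ
  have hβ0 : 0 < β := by linarith
  refine ⟨max 3 ⌈β⌉₊, fun L _ hL => ?_⟩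
  have hL3 : 3 ≤ L := le_of_max_le_left hL
  have hLβ : β ≤ (L : ℝ) := (Nat.le_ceil β).trans (by exact_mod_cast le_of_max_le_right hL)
  have hLr : (0 : ℝ) < L := by exact_mod_cast Nat.pos_of_ne_zero (NeZero.ne L)
  have hμ4 : d₀ ≤ μ + 4 := (min_le_left _ _).trans (by linarith [hμ.1])
  have hμ0 : d₀ ≤ -μ := (min_le_right _ _).trans (by linarith [hμ.2])
  have h := hlaw μ hμ4 hμ0 β hβ L hL3
  have hcmp : 1 / (β * (L : ℝ)) ≤ 1 / β ^ 2 := by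
    rw [sq]
    exact one_div_le_one_div_of_le (by positivity) (mul_le_mul_of_nonneg_left hLβ hβ0.le)
  calc _ ≤ C₁ * (1 / β ^ 2 + 1 / (β * L)) := h
    _ ≤ C₁ * (1 / β ^ 2 + 1 / β ^ 2) := by gcongr
    _ = 2 * C₁ / β ^ 2 := by ring

/-- The same law in the `dWaveSourceTorus L 0 μ 0` spelling of the sourced family at zero source
(for the `ThermalWedge` heat-chord stubs, whose source is decorative at `U = 0`). [folklore] -/
theorem free_dyadicPressure_sub_le_source_zero :
    ∀ μ₁ μ₂ : ℝ, -4 < μ₁ → μ₁ ≤ μ₂ → μ₂ < 0 → ∃ C₁ : ℝ, 0 < C₁ ∧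
      ∀ β : ℝ, 1 ≤ β → ∀ μ ∈ Set.Icc μ₁ μ₂, ∃ L₀ : ℕ, ∀ (L : ℕ) [NeZero L], L₀ ≤ L →
        Real.log (partitionFn (β / 2) (dWaveSourceTorus L 0 μ 0)).re / (β / 2 * (L : ℝ) ^ 2) -
            Real.log (partitionFn β (dWaveSourceTorus L 0 μ 0)).re / (β * (L : ℝ) ^ 2) ≤
          C₁ / β ^ 2 := by
  intro μ₁ μ₂ h4 h12 h0
  obtain ⟨C₁, hC₁, h⟩ := free_dyadicPressure_sub_le μ₁ μ₂ h4 h12 h0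
  refine ⟨C₁, hC₁, fun β hβ μ hμ => ?_⟩
  obtain ⟨L₀, hL₀⟩ := h β hβ μ hμ
  refine ⟨L₀, fun L _ hL => ?_⟩
  simpa only [dWaveSourceTorus_zero] using hL₀ L hL

end Literature.MathematicalPhysics.QuantumLattice
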